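import Summits.QuantumFields.BalabanUV.T4Continuum.Support.NE9ChartRadiusScaling
import Summits.QuantumFields.BalabanUV.T4Continuum.Support.CovariantVectorCoerciveHoloForm

/-!
# NE9ChartRadiusExplicit — Q-S15 CLOSED ON THE TREE AT THE SUBSTRATE'S EXPLICIT LETTERS: NE9's species-(a) chart radius
# `α₁ ∕ lev k` against substrate-p3's FORM-RELATIVE EXPLICIT holomorphy radius `rhoStar γ d a′ |o| ∕ lev k` (p223486) — compatible
# IFF the level-free scalar `α₁ ≤ rhoStar`, and then every point of NE9's analyticity ball is a REGULAR chart point with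
# `‖greenT‖ ≤ 4∕γ` (cell `pub-balaban`, T4-DAG §2 node U3 ∕ §6 NE9; BINDER row NE9 OWNER lineage `b2b-balaban-t4-ne9-p1`,
# generation 33; g32 HANDOFF «ON EVENT: p3's explicit radius ⇒ `HoloRadiusCompat (α₁∕lev) (c√γ∕lev)` wiring»; substrate MAP §5 Q-S15)

HONEST FRAMING (T4-DAG PAGE 1).  Rung (B)+1 of the FINITE-VOLUME T⁴ programme — NOT infinite volume, NOT a mass gap, NOT the
Clay problem.  NE9 (`T4OutputRate.NE9` ∧ `FadingMemory`) is a cell NEW ESTIMATE, NOT PRINTED in [I] = [Balaban1987RG1]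
(CMP **109**), [II] = [Balaban1988RG2Cluster] (CMP **116**), and NOT PROVED for Bałaban's E^{(j)} («NE9 ⇐ the named binders»;
0∕18 leaves instantiated on Bałaban's objects; spine PROVED 0∕9).  HONEST DEPENDENCY (cell line, verbatim): continuum YM on T⁴ ⇐
BetaPertH ∧ nine spine estimates (0/9 proved); BetaPertH ⇐ (D1) ∧ (D4) ∧ CAP+tail; G-an2-4 gates asym, D1 and NE2/3/4.
`FlowStep.BetaPertH`, (B), (B^μ) do not occur.  Compositions BY NAME of g32's `NE9ChartRadiusScaling` (letters) with p3's
`CovariantVectorCoerciveHoloForm` (explicit radius); no definition, no estimate of any object of the series; the S-class smallness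
`α₁ ≤ rhoStar` is DISPLAYED ([I] Thm 1 p. 259 «α₁ sufficiently small»), never adjudicated (ABSOLUTE RULE).  0 sorry.

WHAT.  Q-S15 (typer MAP v0.6.1 §5) was answered (a) + SCALING RIDER (g32, p222672): NE9's radius letters have the form `ρ₀ ∕ lev k`;
the explicit radius NE9 can use is the substrate's FORM-RELATIVE one.  p3 has since LANDED it in exactly that form (p223486:
`rhoStar_div_le_rho1`, `holoRadiusCompat_rhoStar`, `inHoloBallT_rhoStar_subset_regularSetAt`).  THIS FILE composes the two:
* §1 **`holoRadiusCompat_alpha_rhoStar_iff`**: on the tower of record (domains indexed by their level `k : Fin (K+1)`),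
  `HoloRadiusCompat (k ↦ α₁∕lev k) (k ↦ rhoStar γ d a′ co∕lev k) ↔ α₁ ≤ rhoStar γ d a′ co` (g32's `holoRadiusCompat_scaling_iff`
  at `n := lev`); **`holoRadiusCompat_alpha_rho1`**: under that scalar and standard contour lengths `ℓ k ≤ (d+1)·lev k`,
  `HoloRadiusCompat (k ↦ α₁∕lev k) (k ↦ rho1 (lev k) d a′ co (ℓ k) γ)` (`.trans` with p3's `holoRadiusCompat_rhoStar`) — the shape
  NE9's `hkp`-type binders and NE1′'s `hL3` read (`CovariantVectorCoerciveHolo` N-1);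
* §2 **`regular_of_inHoloBallT_alpha`**: for a levelwise-unitary reference tower `R⁰` with `γ`-coercive real slice at level `k`
  and standard contours, EVERY tower coordinate `A` of NE9's species-(a) ball `InHoloBallT R⁰ (α₁∕lev k) A` is a REGULAR chart point at
  level `k` with `‖greenT (lev k) … (expChartT R⁰ A k) (expChartInvT R⁰ A k)‖ ≤ 4∕γ` — p3's `inHoloBallT_rhoStar_subset_regularSetAt`
  through the ball inclusion; i.e. the analyticity domain NE9 DISPLAYS for the species (`CurData.R X := α₁ ∕ lev (scale X)`,
  `MF ⊆ analyticClass D.R`) sits inside the substrate's PROVED holomorphy-with-bounds domain of the operator letters, at the price of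
  the ONE displayed scalar `α₁ ≤ rhoStar γ d a′ |o|`.
DISGUISE TEST: two compositions by name; the smallness is a hypothesis; nothing of Bałaban's is asserted; not NE9.

References (TYPES ∕ loci only): [Balaban1987RG1] T. Bałaban, CMP **109** (1987) 249–301, Thm 1 p. 259, (1.11)–(1.18) pp. 262–263,
(3.53)–(3.55) p. 280; [Balaban1985BackgroundPropagators] T. Bałaban, CMP **99** (1985) 389–434, Sect. B pp. 399–400.  Summits-side NEW
work (LEAN PLACEMENT RULE); imports `NE9ChartRadiusScaling` (p222672) and `CovariantVectorCoerciveHoloForm` (p223486) BY NAME; modifies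
nothing.  Value = a substrate∕row junction closed in the kernel with the smallness it costs named, NOT summit progress.
-/

noncomputable section

open scoped BigOperators Matrix Matrix.Norms.L2Operator

namespace Summit.QuantumFields.BalabanUV.T4Continuum.NE9ChartRadiusExplicit

open Literature.MathematicalPhysics.QuantumFieldTheory.Balaban1983to89 (Params)
open Literature.MathematicalPhysics.QuantumFieldTheory.Balaban1983to89.B5G183RateUnitTower (lev)
open Summit.QuantumFields.BalabanUV.T4Continuum.SubstrateBackgroundTransporters (unitMod)
open Summit.QuantumFields.BalabanUV.T4Continuum.SubstrateTransporterSpecies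
open Summit.QuantumFields.BalabanUV.T4Continuum.SubstrateTransporterSpeciesHolo (expChartT expChartInvT regularSetAt)
open Summit.QuantumFields.BalabanUV.T4Continuum.CovariantBlockAveraging (ContourSystem)
open Summit.QuantumFields.BalabanUV.T4Continuum.CoerciveInverseTower (Coercive)
open Summit.QuantumFields.BalabanUV.T4Continuum.CovariantVectorCoercive (vecOp)
open Summit.QuantumFields.BalabanUV.T4Continuum.CovariantVectorCoerciveHolo (HoloRadiusCompat InHoloBallT)
open Summit.QuantumFields.BalabanUV.T4Continuum.CovariantVectorCoerciveHoloForm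
  (rhoStar rho1 holoRadiusCompat_rhoStar inHoloBallT_rhoStar_subset_regularSetAt)
open Summit.QuantumFields.BalabanUV.T4Continuum.NE9ChartRadiusScaling (holoRadiusCompat_scaling_iff holoRadiusCompat_scaling lev_pos_real)

variable (P : Params)

/-- [folklore] `2 ≤ L` for the parameters of record (`Params.hL : Odd L ∧ 1 < L`). -/
theorem two_le_L : 2 ≤ P.L := P.hL.2

/-- [folklore] the levels of the tower of record are positive reals. -/
theorem lev_pos (j : ℕ) : 0 < ((lev P.L j : ℕ) : ℝ) := lev_pos_real (two_le_L P) j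

/-! ## §1 Compatibility of NE9's `α₁∕lev` with the explicit `rhoStar∕lev` is the scalar `α₁ ≤ rhoStar` -/

/-- [folklore] **Q-S15 AT THE EXPLICIT LETTERS (⇔)**: on the tower of record, NE9's species-(a) chart radii `α₁∕lev k` are
dominated by the substrate's explicit scaling-form holomorphy radii `rhoStar γ d a′ co∕lev k` IFF `α₁ ≤ rhoStar γ d a′ co` — a
level-free scalar (S-class, displayed: [I] Thm 1 p. 259 «α₁ sufficiently small»). [cite: Balaban1987RG1, Thm 1 p.259 and (3.54)-(3.55) p.280] -/
theorem holoRadiusCompat_alpha_rhoStar_iff (α₁ γ a' : ℝ) (co : ℕ) :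
    HoloRadiusCompat (fun k : Fin (P.K + 1) => α₁ / ((lev P.L k : ℕ) : ℝ))
        (fun k : Fin (P.K + 1) => rhoStar γ P.d a' co / ((lev P.L k : ℕ) : ℝ)) ↔ α₁ ≤ rhoStar γ P.d a' co :=
  holoRadiusCompat_scaling_iff (Dom := Fin (P.K + 1)) (fun k => (k : ℕ)) (n := fun j => ((lev P.L j : ℕ) : ℝ)) (lev_pos P)
    (0 : Fin (P.K + 1))

/-- [folklore] **… hence against the form-relative radii `rho1`**: under `α₁ ≤ rhoStar γ d a′ co` and standard contour lengths
`ℓ k ≤ (d+1)·lev k`, `HoloRadiusCompat (k ↦ α₁∕lev k) (k ↦ rho1 (lev k) d a′ co (ℓ k) γ)` (p3's `holoRadiusCompat_rhoStar`,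
transitivity). -/
theorem holoRadiusCompat_alpha_rho1 {α₁ a' γ : ℝ} (ha' : 0 ≤ a') (hγ : 0 < γ) (co : ℕ) (hα : α₁ ≤ rhoStar γ P.d a' co)
    (ℓ : Fin (P.K + 1) → ℕ) (hℓ : ∀ k, (ℓ k : ℝ) ≤ ((P.d : ℝ) + 1) * (lev P.L k : ℕ)) :
    HoloRadiusCompat (fun k : Fin (P.K + 1) => α₁ / ((lev P.L k : ℕ) : ℝ))
      (fun k : Fin (P.K + 1) => rho1 (lev P.L k) P.d a' co (ℓ k) γ) :=
  (holoRadiusCompat_scaling (Dom := Fin (P.K + 1)) (fun k => (k : ℕ)) (n := fun j => ((lev P.L j : ℕ) : ℝ)) (lev_pos P)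
    hα).trans (holoRadiusCompat_rhoStar P ha' hγ co ℓ hℓ)

/-! ## §2 NE9's species-(a) ball consists of regular chart points with the explicit Green's-function bound -/

variable {o : Type*} [Fintype o] [DecidableEq o] [Nonempty o]

omit [Nonempty o] in
/-- [folklore] the ball inclusion: `‖A‖ < α₁∕lev k` and `α₁ ≤ rhoStar …` give `InHoloBallT R⁰ (rhoStar …∕lev k) A`. -/
theorem inHoloBallT_rhoStar_of_alpha {R₀ A : TowerData P o} (k : Fin (P.K + 1)) {α₁ γ a' : ℝ} {co : ℕ}
    (hα : α₁ ≤ rhoStar γ P.d a' co) (hA : InHoloBallT P R₀ (α₁ / ((lev P.L k : ℕ) : ℝ)) A) :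
    InHoloBallT P R₀ (rhoStar γ P.d a' co / ((lev P.L k : ℕ) : ℝ)) A :=
  lt_of_lt_of_le hA (div_le_div_of_nonneg_right hα (lev_pos P k).le)

/-- [folklore] **EVERY POINT OF NE9's SPECIES-(a) BALL IS A REGULAR CHART POINT WITH `‖greenT‖ ≤ 4∕γ`.**  At NE2 level `k`
(letters `c = lev k`, `a = a′·(lev k)^d`), for a levelwise-unitary reference tower `R⁰` whose real slice is `γ`-coercive at level `k`,
contours of length `≤ ℓ ≤ (d+1)·lev k`, and the DISPLAYED scalar `α₁ ≤ rhoStar γ d a′ |o|`: every tower coordinate `A` with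
`InHoloBallT R⁰ (α₁∕lev k) A` lies in `regularSetAt … R⁰ k` and `‖greenT (lev k) … (expChartT R⁰ A k) (expChartInvT R⁰ A k)‖ ≤ 4∕γ`
(p3's `inHoloBallT_rhoStar_subset_regularSetAt` through §2's ball inclusion). [cite: Balaban1985BackgroundPropagators, Sect. B pp.399-400] -/
theorem regular_of_inHoloBallT_alpha (Γ : (k : ℕ) → ContourSystem P.d (lev P.L k) (unitMod P)) {R₀ : TowerData P o}
    (k : Fin (P.K + 1)) {ℓ : ℕ} (hΓ : ∀ y j μ (t : Fin (lev P.L k)), (Γ k y j μ t).length ≤ ℓ)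
    (hℓ : (ℓ : ℝ) ≤ ((P.d : ℝ) + 1) * (lev P.L k : ℕ)) (hR₀ : ∀ ν i, R₀ k ν i ∈ Matrix.unitaryGroup o ℂ) {a' γ : ℝ}
    (ha' : 0 ≤ a') (hco : Coercive γ (vecOp (lev P.L k) (unitMod P) a' (Γ k) (R₀ k))) (hγ : 0 < γ) {α₁ : ℝ}
    (hα : α₁ ≤ rhoStar γ P.d a' (Fintype.card o)) {A : TowerData P o}
    (hA : InHoloBallT P R₀ (α₁ / ((lev P.L k : ℕ) : ℝ)) A) :
    A ∈ regularSetAt P (((lev P.L k : ℕ) : ℂ)) (a' * ((lev P.L k : ℕ) : ℝ) ^ P.d) Γ R₀ k ∧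
      ‖greenT (lev P.L k) (unitMod P) (((lev P.L k : ℕ) : ℂ)) (a' * ((lev P.L k : ℕ) : ℝ) ^ P.d) (Γ k) (expChartT P R₀ A k)
          (expChartInvT P R₀ A k)‖ ≤ 4 / γ :=
  inHoloBallT_rhoStar_subset_regularSetAt P Γ k hΓ hℓ hR₀ ha' hco hγ (inHoloBallT_rhoStar_of_alpha P k hα hA)

end Summit.QuantumFields.BalabanUV.T4Continuum.NE9ChartRadiusExplicit

end
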